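import Summits.HodgeConjecture.CorCM.Census.CyclicCharacterEvenBalancedType

/-!
# Cyclic characters, XXXVIII: EVEN KERNEL, `d = 0` — THE RELATION OF THE OWNED BALANCED FACE: `R(B ∪ {s_{t'}}) ∈ L`

COR-CM (cell `pub-hodgecm2`), count-neutral kernel combinatorics by the binder seat b09 (gen 44; lane CYCLIC-CHARACTER FIBRE LAW, part XXXVIII), on parts
XXXV (canonical lower-left linearisation), XXXVII (the odd-stabilised balanced type and its corners) and the star-form transport
(`Census/TwistScrewShift.mapDomain_rt_thetaG`) BY NAME.  Theorems only (no definition, no `decide` beyond numerals of `ℤ/4`, no certificate, no named fact, no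
`sorry`).  HONEST FRAMING: `HC_CM` is NOT proved, here or anywhere in the tree; nothing here is a period or a headline.

**THEOREM (`rel_of_balancedFace`, `k = 2`, `n = 2m ≥ 4`).**  Let `L = ℤ⟨pairs⟩ + ℤ[G]·S` have the toward property and obey the LOWER RULE on the bottom edge
outside a block `E` avoided by the pure tie `X_B` below `Ψ`; let `Ψ·g⁻¹ = Ψ` with `w g = 1`, and let `L` contain the owned face `gface Ψ s t'` (`s ∈ F_0 ∩ Ψ`,
`t' ∈ F_1 ∖ Ψ`) and the top arc shifts `[T_0^{(u)}] − [T_0] − [T_1^{(u)}] + [T_1]` (`w u = 1`).  Then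
`R(B ∪ {s_{t'}}) = [T_0] − [T_1] + Σ_{q ∈ B ∪ {s_{t'}}} ([T_0^{(q)}] − [T_0]) − Σ_{q ∈ F_0 ∖ (B ∪ {s_{t'}})} ([T_1^{(q)}] − [T_1]) ∈ L`
(`B = F_0 ∖ Ψ`, `s_{t'} = c·t'·g`) — the hypothesis `h3` of part XIXʼs `fib_mem_of_rel`.
PROOF.  The three corners of the face are linearised canonically (part XXXV; two of them after transport by `g⁻¹`, which carries `T_0` to `T_1`), so
`[Ψ] ≡ Ξ := (ε_0(b'))·g + NF_0(Ψ^{(t')})` modulo `L`; as `[Ψ·g] = [Ψ]`, `Ξ − Ξ·g ∈ L`.  Now `(ε_0(b'))·g = η(t')`, `(ε_0(b'))·g² = (ε_0(s_{t'}))·c ≡ −ε_0(s_{t'})`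
modulo pairs (`g⁻¹g⁻¹ = c·ν`, `ν` in the kernel, `b'ν⁻¹ = s_{t'}`), and `NF_0(Ψ^{(t')})·g = [T_1] + Σ_{q ∈ (T_0∖Ψ)∖t'} η(q·g)`, which the two reindexing
bijections of part XXXVII (`B·g = V`, `c·(V∖t')·g = F_0 ∖ (B ∪ {s_{t'}})`) rewrite in the currency of `R`; the top arc shifts absorb `Σ_{V∖t'} (ε_0 − η)`.

## References
* [Pohlmann1968] H. Pohlmann, Algebraic cycles on abelian varieties of complex multiplication type, Ann. of Math. 88 (1968), Thm 1.
-/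

namespace Summit.HodgeConjecture.CorCM.Census.CyclicCharacter

open Finset
open Summit.HodgeConjecture.CorCM.Prior.AllgGroup.RfwfAllgGroup
open Summit.HodgeConjecture.CorCM.Census.BlockParity
open Summit.HodgeConjecture.CorCM.Census.Coinvariant
open Summit.HodgeConjecture.CorCM.Census.TwistGeneration
open Summit.HodgeConjecture.CorCM.Census.BaseBlock

noncomputable section

variable {G : Type*} [Group G] [Fintype G] [DecidableEq G] {k : ℕ} {w : G → ZMod (2 ^ k)} {c : G}

/-! ## §1 Pieces of the relation -/

/-- For `w g = 1`: `T_0·g = T_1` (base change along `g⁻¹`). [folklore] -/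
theorem rt_inv_arcType_zero (hw : ∀ P Q : G, w (P * Q) = w P + w Q) (hk : 1 ≤ k) (hc2 : c * c = 1) (hwc : w c ≠ 0) {g : G} (hg : w g = 1) :
    rt c g⁻¹ (arcType hw hk hc2 hwc 0) = arcType hw hk hc2 hwc 1 := by
  rw [rt_arcType, map_inv hw, hg, sub_neg_eq_add, zero_add]

/-- A kernel element fixes `T_0`. [folklore] -/
theorem rt_arcType_zero_of_ker (hw : ∀ P Q : G, w (P * Q) = w P + w Q) (hk : 1 ≤ k) (hc2 : c * c = 1) (hwc : w c ≠ 0) {ν : G} (hν : w ν = 0) :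
    rt c ν (arcType hw hk hc2 hwc 0) = arcType hw hk hc2 hwc 0 := by
  rw [rt_arcType, hν, sub_zero]

/-- `[X·c] = pair X − [X]`. [folklore] -/
theorem single_rt_self_eq (X : CMF G c) : Finsupp.single (rt c c X) (1 : ℤ) = pair c X - Finsupp.single X 1 := by
  rw [pair, add_sub_cancel_left]

/-- Base change composes: `(y·Q'⁻¹)·Q⁻¹ = y·(QQ')⁻¹` on `ℤ[types]`. [folklore] -/
theorem mapDomain_rt_mapDomain_rt (Q Q' : G) (y : CMF G c →₀ ℤ) :
    Finsupp.mapDomain (rt c Q) (Finsupp.mapDomain (rt c Q') y) = Finsupp.mapDomain (rt c (Q * Q')) y := by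
  rw [← Finsupp.mapDomain_comp]; congr 1; funext Ψ; exact (rt_mul c Q Q' Ψ).symm

/-! ## §2 The relation -/

/-- **THE RELATION OF THE OWNED BALANCED FACE** (see the file header). [folklore] -/
theorem rel_of_balancedFace (hw : ∀ P Q : G, w (P * Q) = w P + w Q) (hk : 1 ≤ k) (hk2 : k = 2) (hc2 : c * c = 1)
    (hcen : ∀ x : G, x * c = c * x) (hwc : w c ≠ 0) (h1 : ∃ g₁ : G, w g₁ = 1) {m : ℕ} (hm : 2 * m = (univ.filter fun s : G => w s = 0).card)
    (S : Finset (CMF G c →₀ ℤ))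
    (htw : ∀ Φ : CMF G c, 2 ≤ bpot c (arcType hw hk hc2 hwc 0) Φ → ∃ Q t t' : G,
      bpot c (arcType hw hk hc2 hwc 0) Φ = ddist (rt c Q (arcType hw hk hc2 hwc 0)) Φ ∧
        t ∈ (rt c Q (arcType hw hk hc2 hwc 0)).1 \ Φ.1 ∧ t' ∈ (rt c Q (arcType hw hk hc2 hwc 0)).1 \ Φ.1 ∧ t ≠ t' ∧
          gface c hc2 Φ t t' ∈ Submodule.span ℤ (pairSet c) ⊔ Submodule.span ℤ (translates c S))
    (E : Block c)
    (htie : ∀ Z : CMF G c, blk c Z ≠ E → 2 ≤ bpot c (arcType hw hk hc2 hwc 0) Z →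
      bpot c (arcType hw hk hc2 hwc 0) Z < (univ.filter fun s : G => w s = 0).card →
      bpot c (arcType hw hk hc2 hwc 0) Z = ddist (arcType hw hk hc2 hwc 0) Z → bpot c (arcType hw hk hc2 hwc 0) Z = ddist (arcType hw hk hc2 hwc 1) Z →
      ∃ s s' : G, s ∈ (arcType hw hk hc2 hwc 0).1 \ Z.1 ∧ s' ∈ (arcType hw hk hc2 hwc 0).1 \ Z.1 ∧ s ≠ s' ∧
        gface c hc2 Z s s' ∈ Submodule.span ℤ (pairSet c) ⊔ Submodule.span ℤ (translates c S))
    {Ψ : CMF G c} {g : G} (hΨ : rt c g Ψ = Ψ) (hg : w g = 1)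
    (hE : ∀ Z : CMF G c, (arcType hw hk hc2 hwc 0).1 \ Z.1 ⊆ (arcType hw hk hc2 hwc 0).1 \ Ψ.1 →
      ((univ.filter fun s : G => w s = 0) \ Z.1).card = m → blk c Z ≠ E)
    {s t' : G} (hs0 : w s = 0) (hsΨ : s ∈ Ψ.1) (ht'1 : w t' = 1) (ht'Ψ : t' ∉ Ψ.1)
    (hface : gface c hc2 Ψ s t' ∈ Submodule.span ℤ (pairSet c) ⊔ Submodule.span ℤ (translates c S))
    (hshift : ∀ u : G, w u = 1 →
      Finsupp.single (oflipCM c hc2 u (arcType hw hk hc2 hwc 0)) (1 : ℤ) - Finsupp.single (arcType hw hk hc2 hwc 0) 1 -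
          Finsupp.single (oflipCM c hc2 u (arcType hw hk hc2 hwc 1)) 1 + Finsupp.single (arcType hw hk hc2 hwc 1) 1 ∈
        Submodule.span ℤ (pairSet c) ⊔ Submodule.span ℤ (translates c S)) :
    Finsupp.single (arcType hw hk hc2 hwc 0) (1 : ℤ) - Finsupp.single (arcType hw hk hc2 hwc 1) 1 +
        (∑ q ∈ insert (c * (t' * g)) ((univ.filter fun s : G => w s = 0) \ Ψ.1),
          (Finsupp.single (oflipCM c hc2 q (arcType hw hk hc2 hwc 0)) (1 : ℤ) - Finsupp.single (arcType hw hk hc2 hwc 0) 1)) -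
        (∑ q ∈ (univ.filter fun s : G => w s = 0) \ insert (c * (t' * g)) ((univ.filter fun s : G => w s = 0) \ Ψ.1),
          (Finsupp.single (oflipCM c hc2 q (arcType hw hk hc2 hwc 1)) (1 : ℤ) - Finsupp.single (arcType hw hk hc2 hwc 1) 1)) ∈
      Submodule.span ℤ (pairSet c) ⊔ Submodule.span ℤ (translates c S) := by
  haveI : Fact (1 < 2 ^ k) := ⟨Nat.one_lt_two_pow (by omega)⟩
  set L := Submodule.span ℤ (pairSet c) ⊔ Submodule.span ℤ (translates c S) with hL
  have hLG : ∀ (Q : G) (y : CMF G c →₀ ℤ), y ∈ L → Finsupp.mapDomain (rt c Q) y ∈ L := fun Q y hy => mapDomain_rt_mem_psp c hcen Q S hy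
  have hpairL : ∀ X : CMF G c, pair c X ∈ L := fun X => Submodule.mem_sup_left (Submodule.subset_span (pair_mem_pairSet c X))
  -- the elements `b' = t'g⁻¹`, `v_s = c s g⁻¹`, `s_{t'} = c t' g`, `ν = c g⁻² `
  obtain ⟨hb'0, hb'Ψ⟩ := bprime_spec hw hΨ hg ht'1 ht'Ψ
  obtain ⟨hvs1, hvsΨ⟩ := vs_spec hw hk hk2 hc2 hwc hΨ hg hs0 hsΨ
  obtain ⟨hst0, hstΨ⟩ := st_spec hw hk hk2 hc2 hwc hΨ hg ht'1 ht'Ψ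
  obtain ⟨hν0, hhh, hb'ν⟩ := nu_spec hw hk hk2 hc2 hcen hwc hg t'
  have hTone : rt c g⁻¹ (arcType hw hk hc2 hwc 0) = (arcType hw hk hc2 hwc 1) := rt_inv_arcType_zero hw hk hc2 hwc hg
  have hb'g : t' * g⁻¹ * g = t' := inv_mul_cancel_right t' g
  have hb'T : t' * g⁻¹ ∈ (arcType hw hk hc2 hwc 0).1 := (mem_arcType_iff_of_two hw hk hk2 hc2 hwc 0 _).mpr (Or.inl hb'0)
  have hb'D : t' * g⁻¹ ∈ (arcType hw hk hc2 hwc 0).1 \ Ψ.1 := mem_sdiff.mpr ⟨hb'T, hb'Ψ⟩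
  have hvsb' : c * (s * g⁻¹) ≠ t' * g⁻¹ := fun h => by have := congrArg w h; rw [hvs1, hb'0] at this; exact one_ne_zero this
  have hstB : c * (t' * g) ∉ (univ.filter fun s : G => w s = 0) \ Ψ.1 := fun h => (mem_sdiff.mp h).2 hstΨ
  have ht'V : t' ∈ (univ.filter fun s : G => w s = 1) \ Ψ.1 := mem_sdiff.mpr ⟨mem_filter.mpr ⟨mem_univ _, ht'1⟩, ht'Ψ⟩
  have hDsplit : (arcType hw hk hc2 hwc 0).1 \ Ψ.1 = ((univ.filter fun s : G => w s = 0) \ Ψ.1) ∪ ((univ.filter fun s : G => w s = 1) \ Ψ.1) := by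
    rw [sdiff_arcType_eq_union hw hk hk2 hc2 hwc, zero_add]
  have hBV : Disjoint ((univ.filter fun s : G => w s = 0) \ Ψ.1) ((univ.filter fun s : G => w s = 1) \ Ψ.1) := disjoint_fib_sdiff 0 1 zero_ne_one Ψ
  have ht'B : t' ∉ (univ.filter fun s : G => w s = 0) \ Ψ.1 := fun h => by
    have := (mem_filter.mp (mem_sdiff.mp h).1).2; rw [ht'1] at this; exact one_ne_zero this
  -- the three corners and their canonical linearisations
  obtain ⟨hdev1, hb1, hv1⟩ := corner_one_spec hw hk hk2 hc2 hwc h1 hm hΨ hg ht'1 ht'Ψ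
  obtain ⟨hrt2, hdev2, hb2, hv2⟩ := corner_two_spec hw hk hk2 hc2 hwc h1 hm hΨ hg hs0 hsΨ
  obtain ⟨hrt3, hdev3, hb3, hv3⟩ := corner_three_spec hw hk hk2 hc2 hwc h1 hm hΨ hg hs0 hsΨ ht'1 ht'Ψ
  have hE1 : ∀ Z : CMF G c, (arcType hw hk hc2 hwc 0).1 \ Z.1 ⊆ (arcType hw hk hc2 hwc 0).1 \ (oflipCM c hc2 t' Ψ).1 → ((univ.filter fun s : G => w s = 0) \ Z.1).card = m → blk c Z ≠ E :=
    fun Z hZ hZm => hE Z (hZ.trans (by rw [hdev1]; exact erase_subset _ _)) hZm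
  have hE2 : ∀ Z : CMF G c, (arcType hw hk hc2 hwc 0).1 \ Z.1 ⊆ (arcType hw hk hc2 hwc 0).1 \ (oflipCM c hc2 (c * (s * g⁻¹)) Ψ).1 → ((univ.filter fun s : G => w s = 0) \ Z.1).card = m → blk c Z ≠ E :=
    fun Z hZ hZm => hE Z (hZ.trans (by rw [hdev2]; exact erase_subset _ _)) hZm
  have hE3 : ∀ Z : CMF G c, (arcType hw hk hc2 hwc 0).1 \ Z.1 ⊆ (arcType hw hk hc2 hwc 0).1 \ (oflipCM c hc2 (c * (s * g⁻¹)) (oflipCM c hc2 (t' * g⁻¹) Ψ)).1 →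
      ((univ.filter fun s : G => w s = 0) \ Z.1).card = m → blk c Z ≠ E :=
    fun Z hZ hZm => hE Z (hZ.trans (by rw [hdev3]; exact (erase_subset _ _).trans (erase_subset _ _))) hZm
  have e1 := single_sub_normalForm_mem_of_lowerLeft hw hk hk2 hc2 hwc h1 L htw hm E htie (oflipCM c hc2 t' Ψ) hb1.le (by omega) hE1
  have e2 := single_sub_thetaG_rt_mem_of_lowerLeft hw hk hk2 hc2 hwc h1 L hLG htw hm E htie (oflipCM c hc2 (c * (s * g⁻¹)) Ψ) hb2.le
    (by omega) hE2 g⁻¹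
  have e3 := single_sub_thetaG_rt_mem_of_lowerLeft hw hk hk2 hc2 hwc h1 L hLG htw hm E htie
    (oflipCM c hc2 (c * (s * g⁻¹)) (oflipCM c hc2 (t' * g⁻¹) Ψ)) (by omega) (by omega) hE3 g⁻¹
  rw [← mapDomain_rt_thetaG, thetaG_typeSum_single, hdev2, hrt2] at e2
  rw [← mapDomain_rt_thetaG, thetaG_typeSum_single, hdev3, hrt3] at e3
  rw [hdev1] at e1
  -- `NF_0(Y₂) − NF_0(Y₃) = ε_0(b')`
  have hb'mem : t' * g⁻¹ ∈ ((arcType hw hk hc2 hwc 0).1 \ Ψ.1).erase (c * (s * g⁻¹)) := mem_erase.mpr ⟨hvsb'.symm, hb'D⟩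
  have hNF23 : ((∑ t ∈ ((arcType hw hk hc2 hwc 0).1 \ Ψ.1).erase (c * (s * g⁻¹)), (Finsupp.single (oflipCM c hc2 t (arcType hw hk hc2 hwc 0)) (1 : ℤ) - Finsupp.single (arcType hw hk hc2 hwc 0) 1)) +
        Finsupp.single (arcType hw hk hc2 hwc 0) 1) -
      ((∑ t ∈ (((arcType hw hk hc2 hwc 0).1 \ Ψ.1).erase (t' * g⁻¹)).erase (c * (s * g⁻¹)), (Finsupp.single (oflipCM c hc2 t (arcType hw hk hc2 hwc 0)) (1 : ℤ) - Finsupp.single (arcType hw hk hc2 hwc 0) 1)) +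
        Finsupp.single (arcType hw hk hc2 hwc 0) 1) =
      Finsupp.single (oflipCM c hc2 (t' * g⁻¹) (arcType hw hk hc2 hwc 0)) (1 : ℤ) - Finsupp.single (arcType hw hk hc2 hwc 0) 1 := by
    rw [erase_right_comm, ← add_sum_erase _ _ hb'mem]; abel
  -- `[Ψ] − (ε_0(b')·g + NF_0(X₁)) ∈ L`
  have hD1 : Finsupp.single Ψ (1 : ℤ) - Finsupp.mapDomain (rt c g⁻¹) (Finsupp.single (oflipCM c hc2 (t' * g⁻¹) (arcType hw hk hc2 hwc 0)) (1 : ℤ) - Finsupp.single (arcType hw hk hc2 hwc 0) 1) -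
      ((∑ t ∈ ((arcType hw hk hc2 hwc 0).1 \ Ψ.1).erase t', (Finsupp.single (oflipCM c hc2 t (arcType hw hk hc2 hwc 0)) (1 : ℤ) - Finsupp.single (arcType hw hk hc2 hwc 0) 1)) + Finsupp.single (arcType hw hk hc2 hwc 0) 1) ∈ L := by
    have h := Submodule.add_mem _ (Submodule.add_mem _ (Submodule.sub_mem _ hface e3) e2) e1
    rw [← hNF23, Finsupp.mapDomain_sub]
    convert h using 1
    simp only [gface]
    abel
  -- apply `g⁻¹` once more and subtract: `Ξ − Ξ·g ∈ L`
  have hD1' := hLG g⁻¹ _ hD1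
  rw [Finsupp.mapDomain_sub, Finsupp.mapDomain_sub, Finsupp.mapDomain_single, rt_inv_eq_self_of_rt_eq hΨ] at hD1'
  have hρ := Submodule.sub_mem _ hD1' hD1
  -- piece 1: `ε_0(b')·g = η(t')`
  have p1 : Finsupp.mapDomain (rt c g⁻¹) (Finsupp.single (oflipCM c hc2 (t' * g⁻¹) (arcType hw hk hc2 hwc 0)) (1 : ℤ) - Finsupp.single (arcType hw hk hc2 hwc 0) 1) =
      Finsupp.single (oflipCM c hc2 t' (arcType hw hk hc2 hwc 1)) (1 : ℤ) - Finsupp.single (arcType hw hk hc2 hwc 1) 1 := by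
    rw [Finsupp.mapDomain_sub, Finsupp.mapDomain_single, Finsupp.mapDomain_single, rt_oflipCM, inv_inv, hb'g, hTone]
  -- piece 2: `ε_0(b')·g² = (pair − pair) − ε_0(s_{t'})`
  have p2 : Finsupp.mapDomain (rt c g⁻¹) (Finsupp.mapDomain (rt c g⁻¹)
      (Finsupp.single (oflipCM c hc2 (t' * g⁻¹) (arcType hw hk hc2 hwc 0)) (1 : ℤ) - Finsupp.single (arcType hw hk hc2 hwc 0) 1)) =
      (pair c (oflipCM c hc2 (c * (t' * g)) (arcType hw hk hc2 hwc 0)) - pair c (arcType hw hk hc2 hwc 0)) -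
        (Finsupp.single (oflipCM c hc2 (c * (t' * g)) (arcType hw hk hc2 hwc 0)) (1 : ℤ) - Finsupp.single (arcType hw hk hc2 hwc 0) 1) := by
    rw [mapDomain_rt_mapDomain_rt, hhh, Finsupp.mapDomain_sub, Finsupp.mapDomain_single, Finsupp.mapDomain_single,
      rt_mul c c (c * g⁻¹ * g⁻¹), rt_mul c c (c * g⁻¹ * g⁻¹), rt_oflipCM, rt_arcType_zero_of_ker hw hk hc2 hwc hν0, hb'ν,
      single_rt_self_eq, single_rt_self_eq]
    abel
  -- piece 3: `NF_0(X₁)·g = [T_1] + Σ_{V} η + Σ_{F_0 ∖ (B ∪ s_{t'})} η`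
  have hsumB : (∑ q ∈ (univ.filter fun s : G => w s = 0) \ Ψ.1, (Finsupp.single (oflipCM c hc2 (q * g) (arcType hw hk hc2 hwc 1)) (1 : ℤ) - Finsupp.single (arcType hw hk hc2 hwc 1) 1)) =
      ∑ q ∈ (univ.filter fun s : G => w s = 1) \ Ψ.1, (Finsupp.single (oflipCM c hc2 q (arcType hw hk hc2 hwc 1)) (1 : ℤ) - Finsupp.single (arcType hw hk hc2 hwc 1) 1) := by
    rw [← image_bottom_mul_eq_top hw hΨ hg, sum_image fun x _ y _ h => mul_right_cancel h]
  have hsumV : (∑ q ∈ ((univ.filter fun s : G => w s = 1) \ Ψ.1).erase t', (Finsupp.single (oflipCM c hc2 (q * g) (arcType hw hk hc2 hwc 1)) (1 : ℤ) - Finsupp.single (arcType hw hk hc2 hwc 1) 1)) =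
      ∑ q ∈ (univ.filter fun s : G => w s = 0) \ insert (c * (t' * g)) ((univ.filter fun s : G => w s = 0) \ Ψ.1), (Finsupp.single (oflipCM c hc2 q (arcType hw hk hc2 hwc 1)) (1 : ℤ) - Finsupp.single (arcType hw hk hc2 hwc 1) 1) := by
    rw [← image_top_erase_eq hw hk hk2 hc2 hwc hΨ hg ht'1, sum_image fun x _ y _ h => mul_right_cancel (mul_left_cancel h)]
    exact sum_congr rfl fun q _ => by rw [oflipCM_cmul]
  have p3 : Finsupp.mapDomain (rt c g⁻¹) ((∑ t ∈ ((arcType hw hk hc2 hwc 0).1 \ Ψ.1).erase t', (Finsupp.single (oflipCM c hc2 t (arcType hw hk hc2 hwc 0)) (1 : ℤ) - Finsupp.single (arcType hw hk hc2 hwc 0) 1)) +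
      Finsupp.single (arcType hw hk hc2 hwc 0) 1) =
      (∑ q ∈ (univ.filter fun s : G => w s = 1) \ Ψ.1, (Finsupp.single (oflipCM c hc2 q (arcType hw hk hc2 hwc 1)) (1 : ℤ) - Finsupp.single (arcType hw hk hc2 hwc 1) 1)) +
        (∑ q ∈ (univ.filter fun s : G => w s = 0) \ insert (c * (t' * g)) ((univ.filter fun s : G => w s = 0) \ Ψ.1), (Finsupp.single (oflipCM c hc2 q (arcType hw hk hc2 hwc 1)) (1 : ℤ) - Finsupp.single (arcType hw hk hc2 hwc 1) 1)) +
          Finsupp.single (arcType hw hk hc2 hwc 1) 1 := by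
    rw [Finsupp.mapDomain_add, Finsupp.mapDomain_finsetSum, Finsupp.mapDomain_single, hTone]
    simp only [Finsupp.mapDomain_sub, Finsupp.mapDomain_single, rt_oflipCM, inv_inv, hTone]
    rw [hDsplit, erase_union_distrib, erase_eq_of_notMem ht'B, sum_union (hBV.mono_right (erase_subset _ _)), hsumB, hsumV]
  -- piece 4: `NF_0(X₁) = [T_0] + Σ_B ε + Σ_{V∖t'} ε`
  have p4 : ((∑ t ∈ ((arcType hw hk hc2 hwc 0).1 \ Ψ.1).erase t', (Finsupp.single (oflipCM c hc2 t (arcType hw hk hc2 hwc 0)) (1 : ℤ) - Finsupp.single (arcType hw hk hc2 hwc 0) 1)) + Finsupp.single (arcType hw hk hc2 hwc 0) 1) =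
      (∑ q ∈ (univ.filter fun s : G => w s = 0) \ Ψ.1, (Finsupp.single (oflipCM c hc2 q (arcType hw hk hc2 hwc 0)) (1 : ℤ) - Finsupp.single (arcType hw hk hc2 hwc 0) 1)) +
        (∑ q ∈ ((univ.filter fun s : G => w s = 1) \ Ψ.1).erase t', (Finsupp.single (oflipCM c hc2 q (arcType hw hk hc2 hwc 0)) (1 : ℤ) - Finsupp.single (arcType hw hk hc2 hwc 0) 1)) + Finsupp.single (arcType hw hk hc2 hwc 0) 1 := by
    rw [hDsplit, erase_union_distrib, erase_eq_of_notMem ht'B, sum_union (hBV.mono_right (erase_subset _ _))]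
  -- the shifts of `V ∖ t'` and the pairs
  have hY : (∑ q ∈ ((univ.filter fun s : G => w s = 1) \ Ψ.1).erase t', (Finsupp.single (oflipCM c hc2 q (arcType hw hk hc2 hwc 0)) (1 : ℤ) - Finsupp.single (arcType hw hk hc2 hwc 0) 1 -
      Finsupp.single (oflipCM c hc2 q (arcType hw hk hc2 hwc 1)) 1 + Finsupp.single (arcType hw hk hc2 hwc 1) 1)) ∈ L :=
    Submodule.sum_mem _ fun q hq => hshift q (mem_filter.mp (mem_sdiff.mp (mem_of_mem_erase hq)).1).2
  have hP : pair c (oflipCM c hc2 (c * (t' * g)) (arcType hw hk hc2 hwc 0)) - pair c (arcType hw hk hc2 hwc 0) ∈ L := Submodule.sub_mem _ (hpairL _) (hpairL _)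
  -- assemble
  have hres := Submodule.sub_mem _ (Submodule.add_mem _ hρ hP) hY
  rw [p2, p1, p3, p4, ← add_sum_erase _ _ ht'V] at hres
  rw [sum_insert hstB]
  simp only [sum_sub_distrib, sum_add_distrib] at hres ⊢
  convert hres using 1
  abel
end

end Summit.HodgeConjecture.CorCM.Census.CyclicCharacter
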